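import Mathlib

/-!
# Route `UnthreadedDoor`, crux `PoloidalLiouville` (stmt-NavierStokesRegularity-1222), wall W1 — crux idea
# «flux-starved-dipoles» (ns-idea-15 g12/g13, `Cruxes/PoloidalLiouville/FluxStarvedDipoleSketch.lean`):
# the AMPLITUDE INEQUALITY of K1 from the pole identity `ℓ = 0` (one-variable half of `AmplitudeLawSteady`)

Companion of `…FluxStarvedDipoleConvexEndgame` (p836018, the sketch Prop `ConvexEndgame`).  K1 (`DipoleNeverSteady`) is composed
in the sketch as `AmplitudeLawSteady → ConvexEndgame → DipoleNeverSteady`; `AmplitudeLawSteady` says that the amplitude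
`w(r) = r·‖A(r)‖` of a steadily maintained toroidal dipole `T = ⟪A(r), ξ⟫ + R(r)` satisfies `w ∈ C²` and `w″ ≥ 2w/r²` wherever
`A ≠ 0`.  On paper (card §Proof steps 3–4) this splits into
  (PDE half)  flux starvation + the reduced scalar law evaluated at the two poles `±Â(r)` of the sphere `S_r` give the POLE
              IDENTITY `ℓ(r) := ⟪A″ + (2/r)A′ − (2/r²)A, A⟫(r) = 0` (the card's `∂ₜa = ℓ` with `∂ₜ = 0`, multiplied by `a`);
  (ODE half)  `ℓ = 0` and Cauchy–Schwarz `⟪A, A′⟫² ≤ ‖A‖²‖A′‖²` give `w″ − 2w/r² = r(‖A′‖² − a′²)/a = r·a·‖Â′‖² ≥ 0`.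
THIS FILE proves the ODE half, for a curve `A` in any real inner-product space:

`FluxStarvedDipole.amplitude_law_of_poleIdentity`: if `A` is `C²` at `r > 0`, `A r ≠ 0` and
`⟪iteratedDeriv 2 A r + (2/r) • deriv A r − (2/r²) • A r, A r⟫ = 0`, then `s ↦ s·‖A s‖` is `C²` at `r` and
`2·(r‖A r‖)/r² ≤ iteratedDeriv 2 (s ↦ s·‖A s‖) r` — literally the conclusion shape of the sketch's `AmplitudeLawSteady`
(`amplitude A = fun r => r * ‖A r‖`).

What remains for `AmplitudeLawSteady` after this file is the PDE half alone (pole identity from `SteadyKinematicLawOn` + sphere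
tangency), and for K1 the Prop `FluxStarvationSteady` (zero net flux through spheres + latitude-circle averaging).

HONEST LABEL: one-variable calculus in the LINEAR kinematic shadow of W1 (critic V28: W1 movement 0); `AmplitudeLawSteady`,
`FluxStarvationSteady`, K1, `PoloidalLiouville` (1222), its wall `stub_scalarLiouville` and the summit stay OPEN; NO Navier–Stokes
regularity statement is proved.  `--supports stmt-NavierStokesRegularity-1222` (helper).  [folklore]
-/

noncomputable section

-- the summit and its single sub-problem share the name (CONVENTIONS §1)
set_option linter.dupNamespace false

open Set Filter Topology
open scoped RealInnerProductSpace

namespace Summit.NavierStokesRegularity.NavierStokesRegularity.Theorems.PoloidalLiouville.FluxStarvedDipole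

variable {F : Type*} [NormedAddCommGroup F] [InnerProductSpace ℝ F]

/-- A `C²` curve in a normed space: `deriv A` has derivative `iteratedDeriv 2 A r` at `r`. [folklore] -/
theorem amplitude_hasDerivAt_deriv {A : ℝ → F} {r : ℝ} (h : ContDiffAt ℝ 2 A r) :
    HasDerivAt (deriv A) (iteratedDeriv 2 A r) r := by
  have h2 : DifferentiableAt ℝ (deriv A) r := by
    have h1 : ContDiffAt ℝ 1 (fderiv ℝ A) r := h.fderiv_right (le_of_eq one_add_one_eq_two)
    have h1' : DifferentiableAt ℝ (fderiv ℝ A) r := h1.differentiableAt one_ne_zero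
    have := h1'.clm_apply (differentiableAt_const (1 : ℝ))
    simpa only [fderiv_apply_one_eq_deriv] using this
  rw [iteratedDeriv_succ, iteratedDeriv_one]
  exact h2.hasDerivAt

/-- Derivative of the norm along a differentiable curve away from the origin: `(‖A‖)′ = ⟪A, A′⟫/‖A‖`. [folklore] -/
theorem amplitude_hasDerivAt_norm {A : ℝ → F} {A' : F} {s : ℝ} (h : HasDerivAt A A' s) (h0 : A s ≠ 0) :
    HasDerivAt (fun x => ‖A x‖) (⟪A s, A'⟫ / ‖A s‖) s := by
  have hsq : HasDerivAt (fun x => ‖A x‖ ^ 2) (2 * ⟪A s, A'⟫) s := h.norm_sq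
  have hne : ‖A s‖ ^ 2 ≠ 0 := pow_ne_zero 2 (norm_ne_zero_iff.mpr h0)
  have h1 := hsq.sqrt hne
  have hfun : (fun x => Real.sqrt (‖A x‖ ^ 2)) = fun x => ‖A x‖ :=
    funext fun x => Real.sqrt_sq (norm_nonneg _)
  rw [hfun, Real.sqrt_sq (norm_nonneg _)] at h1
  exact h1.congr_deriv (mul_div_mul_left _ _ two_ne_zero)

/-- Cauchy–Schwarz in the form used below: `⟪x, y⟫² ≤ ‖x‖²·⟪y, y⟫`. [folklore] -/
theorem amplitude_inner_sq_le (x y : F) : ⟪x, y⟫ ^ 2 ≤ ‖x‖ ^ 2 * ⟪y, y⟫ := by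
  have h1 := abs_real_inner_le_norm x y
  have h2 : |⟪x, y⟫| ^ 2 ≤ (‖x‖ * ‖y‖) ^ 2 := pow_le_pow_left₀ (abs_nonneg _) h1 2
  rw [sq_abs, mul_pow, ← real_inner_self_eq_norm_sq y] at h2
  exact h2

/-- The algebra of the ODE half: with `a = ‖A‖ > 0`, `p = ⟪A, A′⟫`, `q = ⟪A′, A′⟫`, `c = ⟪A, A″⟫`, Cauchy–Schwarz `p² ≤ a²q`
and the pole identity `c + (2/r)p − (2/r²)a² = 0`, the computed value of `w″(r)` dominates `2w/r² = 2(ra)/r²`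
(the difference is `r(a²q − p²)/a³ ≥ 0`). [folklore] -/
theorem amplitude_algebra (a p q c r : ℝ) (ha : 0 < a) (hr : 0 < r) (hcs : p ^ 2 ≤ a ^ 2 * q)
    (hℓ : c + 2 / r * p - 2 / r ^ 2 * a ^ 2 = 0) :
    2 * (r * a) / r ^ 2 ≤ p / a + (1 * (p / a) + r * (((c + q) * a - p * (p / a)) / a ^ 2)) := by
  have ha0 : a ≠ 0 := ha.ne'
  have hr0 : r ≠ 0 := hr.ne'
  have hc : c = -(2 / r * p) + 2 / r ^ 2 * a ^ 2 := by linarith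
  have key : p / a + (1 * (p / a) + r * (((c + q) * a - p * (p / a)) / a ^ 2)) - 2 * (r * a) / r ^ 2
      = r * (a ^ 2 * q - p ^ 2) / a ^ 3 := by
    rw [hc]
    field_simp
    ring
  have hnn : 0 ≤ r * (a ^ 2 * q - p ^ 2) / a ^ 3 :=
    div_nonneg (mul_nonneg hr.le (by linarith)) (pow_pos ha 3).le
  linarith

/-- **AMPLITUDE LAW FROM THE POLE IDENTITY** (ODE half of `AmplitudeLawSteady`, crux card «flux-starved-dipoles», K1).
Let `A : ℝ → F` be `C²` at `r > 0` with `A r ≠ 0` and `⟪A″(r) + (2/r)A′(r) − (2/r²)A(r), A(r)⟫ = 0`.  Then the amplitude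
`w(s) = s·‖A s‖` is `C²` at `r` and `2·w(r)/r² ≤ w″(r)` — the conclusion of the sketch's `AmplitudeLawSteady` at `r`
(with `amplitude A` unfolded).  W1 / `PoloidalLiouville` / NS regularity are NOT touched. [folklore] -/
theorem amplitude_law_of_poleIdentity (A : ℝ → F) {r : ℝ} (hr : 0 < r) (hA : ContDiffAt ℝ 2 A r)
    (hA0 : A r ≠ 0)
    (hℓ : ⟪iteratedDeriv 2 A r + (2 / r) • deriv A r - (2 / r ^ 2) • A r, A r⟫ = 0) :
    ContDiffAt ℝ 2 (fun s => s * ‖A s‖) r ∧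
      2 * (r * ‖A r‖) / r ^ 2 ≤ iteratedDeriv 2 (fun s => s * ‖A s‖) r := by
  refine ⟨contDiffAt_id.mul (hA.norm ℝ hA0), ?_⟩
  -- a neighbourhood of `r` on which `A` is `C²` and non-zero
  have hev1 : ∀ᶠ s in 𝓝 r, ContDiffAt ℝ 2 A s := hA.eventually (by simp)
  have hev2 : ∀ᶠ s in 𝓝 r, A s ≠ 0 := hA.continuousAt.eventually_ne hA0
  -- the first derivative of the amplitude near `r`
  have hWd : ∀ᶠ s in 𝓝 r,
      HasDerivAt (fun x => x * ‖A x‖) (‖A s‖ + s * (⟪A s, deriv A s⟫ / ‖A s‖)) s := by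
    filter_upwards [hev1, hev2] with s hs1 hs2
    have hAd : HasDerivAt A (deriv A s) s := (hs1.differentiableAt (by norm_num)).hasDerivAt
    have hn := amplitude_hasDerivAt_norm hAd hs2
    exact ((hasDerivAt_id' (x := s)).fun_mul hn).congr_deriv (by rw [one_mul])
  have hderivW : deriv (fun x => x * ‖A x‖) =ᶠ[𝓝 r] fun s => ‖A s‖ + s * (⟪A s, deriv A s⟫ / ‖A s‖) :=
    hWd.mono fun s hs => hs.deriv
  -- the second derivative at `r`
  have hAd : HasDerivAt A (deriv A r) r := (hA.differentiableAt (by norm_num)).hasDerivAt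
  have hA2 : HasDerivAt (deriv A) (iteratedDeriv 2 A r) r := amplitude_hasDerivAt_deriv hA
  have hn : HasDerivAt (fun x => ‖A x‖) (⟪A r, deriv A r⟫ / ‖A r‖) r := amplitude_hasDerivAt_norm hAd hA0
  have ha0 : ‖A r‖ ≠ 0 := norm_ne_zero_iff.mpr hA0
  have hin := HasDerivAt.inner ℝ hAd hA2
  have hquot := hin.fun_div hn ha0
  have hprod := (hasDerivAt_id' (x := r)).fun_mul hquot
  have hsum := hn.fun_add hprod
  have h2nd : iteratedDeriv 2 (fun s => s * ‖A s‖) r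
      = ⟪A r, deriv A r⟫ / ‖A r‖ + (1 * (⟪A r, deriv A r⟫ / ‖A r‖) + r *
          (((⟪A r, iteratedDeriv 2 A r⟫ + ⟪deriv A r, deriv A r⟫) * ‖A r‖
            - ⟪A r, deriv A r⟫ * (⟪A r, deriv A r⟫ / ‖A r‖)) / ‖A r‖ ^ 2)) := by
    rw [iteratedDeriv_succ, iteratedDeriv_one, hderivW.deriv_eq]
    exact hsum.deriv
  -- the pole identity, expanded
  have hℓ' : ⟪A r, iteratedDeriv 2 A r⟫ + 2 / r * ⟪A r, deriv A r⟫ - 2 / r ^ 2 * ‖A r‖ ^ 2 = 0 := by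
    rw [inner_sub_left, inner_add_left, real_inner_smul_left, real_inner_smul_left,
      real_inner_self_eq_norm_sq, real_inner_comm (A r) (iteratedDeriv 2 A r),
      real_inner_comm (A r) (deriv A r)] at hℓ
    exact hℓ
  rw [h2nd]
  exact amplitude_algebra ‖A r‖ ⟪A r, deriv A r⟫ ⟪deriv A r, deriv A r⟫ ⟪A r, iteratedDeriv 2 A r⟫ r
    (norm_pos_iff.mpr hA0) hr (amplitude_inner_sq_le (A r) (deriv A r)) hℓ'

end Summit.NavierStokesRegularity.NavierStokesRegularity.Theorems.PoloidalLiouville.FluxStarvedDipole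

end
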